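import Literature.AlgebraicGeometry.Motives.HodgeStructureAbelianType
import Literature.AlgebraicGeometry.Motives.MumfordTateInvariantsTensorPolarization
import Literature.AlgebraicGeometry.Motives.WeilTypePolarization
import Literature.AlgebraicGeometry.Motives.HodgeTensorHodgeGroupEndAlgProofs
import Literature.AlgebraicGeometry.HodgeTheory.HodgeRiemannPolarizabilityProofs
import Literature.AlgebraicGeometry.HodgeTheory.ClassesSupportedOnComplexification
import HarnessLib

/-!
# Hodge structures of abelian type are polarizable

Family `hodge`, layer `Literature/AlgebraicGeometry/Motives` (lane `lit-hodgefound`, Layer B node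
B3-17 / TRIBUNAL-B B15: structural consequences of the predicate `HodgeStructure.IsOfAbelianType`
of `Motives/HodgeStructureAbelianType`). THEOREMS ONLY; nothing unproved is asserted (the one
`def` below is the linear map `x ↦ x ⊗ ⊗()`, `V^{⊗m} → T^{m,0} V = V^{⊗m} ⊗ (V^∨)^{⊗0}`, plumbing
between the tree's `HodgeStructure.tensorPower` and `HodgeStructure.tensorSpace`).

Sources read verbatim. Y. André, *Pour une théorie inconditionnelle des motifs*, Publ. Math. IHÉS
83 (1996) [Andre1996Motifs] (held text `paper:doi-10-1007-bf02698643`), Thm. 0.4 (p. 8, PDF p. 5):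
"la catégorie […] `ℳ(𝒱)` […] est tannakienne […] graduée, semi-simple, polarisée", and §6.1
(p. 30): `ℳ(𝒜b)_𝒱` is "la sous-catégorie tannakienne […] engendrée par les `𝔥(A)` et les motifs
d'Artin" — a full subcategory of a polarised category, stable under subobjects: its Betti–Hodge
realisations are polarisable `ℚ`-Hodge structures. C. Voisin, *Hodge Theory and Complex Algebraic
Geometry I* [VoisinHodgeI2002], §7.1.2 (the Hodge structure of a smooth projective variety is
polarised; a sub-Hodge structure of a polarised Hodge structure is polarised by the restricted
form — the tree's `HodgeTheory.smoothProjective_hodgeStructure_isPolarizable_holds` and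
`HodgeStructure.Polarization.comap`) and §7.3.1; P. Deligne, *Théorie de Hodge II*
[DeligneHodgeII1971] (cite-only, acq-00429), 2.1.15 (polarisations as morphisms
`H ⊗ H → ℚ(-n)`; tensor products and Tate twists of polarised structures are polarised) with
M. Green, P. Griffiths, M. Kerr, *Mumford–Tate groups and domains* [GGK] I.A (the induced
polarisation on the tensor spaces `T^{a,b}`; the tree's `HodgeStructure.Polarization.tensorSpace`).

## What is proved

* `HodgeStructure.IsPolarizable.tensorPower` — tensor powers `H^{⊗m}` of a polarisable Hodge
  structure on a finite-dimensional `V` are polarisable (pull back the tree's tensor-space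
  polarisation of `T^{m,0} H` along the injective morphism `x ↦ x ⊗ ⊗()`,
  `HodgeStructure.Hom.toTensorSpaceZero`).
* `HodgeStructure.isPolarizable_abelianTensor` — the generators `(H¹(A(ℂ); ℚ)^{⊗ m})(c)` of
  André's `ℳ(𝒜b)` on the Hodge side are polarisable (`H¹(A)` is polarised: Voisin I §7.1.2, the
  tree's theorem `smoothProjective_hodgeStructure_isPolarizable_holds`; then tensor power, Tate
  twist, transport of the weight).
* `HodgeStructure.IsOfAbelianType.isPolarizable` — **a `ℚ`-Hodge structure of abelian type is
  polarisable**: a direct summand `H` of `(H¹(A)^{⊗ m})(c)` through `(j, r)` is polarised by the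
  form pulled back along the injective morphism `j` (`Polarization.comap`).
* `HodgeStructure.IsOfAbelianType.finiteDimensional` — its underlying space is finite-dimensional;
  `HodgeStructure.IsOfAbelianType.exists_isCompl` — hence (Voisin 2025 Prop. 2.11 / Voisin I
  Lemma 7.26, the tree's `SubHodgeStructure.exists_isCompl`) every sub-Hodge structure of a Hodge
  structure of abelian type has a complementary sub-Hodge structure (semisimplicity of `ℳ(𝒜b)`,
  André Thm. 0.4, on the Hodge side).
-/

noncomputable section

open scoped TensorProduct
open Literature.AlgebraicTopology.SingularHomology

universe u

namespace Literature.AlgebraicGeometry.Motives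

namespace HodgeStructure

variable {V : Type u} [AddCommGroup V] [Module ℚ V] {n : ℤ}

/-! ### `V^{⊗m} ↪ T^{m,0} V`, `x ↦ x ⊗ ⊗()` -/

section TensorSpaceZero

variable (V) in
/-- The linear map `x ↦ x ⊗ ⊗()` from the tensor power `V^{⊗m}` to the tensor space
`T^{m,0} V = V^{⊗m} ⊗ (V^∨)^{⊗0}` of the tree (`hodgeTensorSpace V m 0`; Deligne, LNM 900, I §3.1:
`T^{a,b} = V^{⊗a} ⊗ (V^∨)^{⊗b}`, `(V^∨)^{⊗0} = ℚ`). Plumbing. [cite: Deligne1982HodgeCycles, I §3.1] -/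
def toTensorSpaceZero (m : ℕ) : (⨂[ℚ]^m V) →ₗ[ℚ] hodgeTensorSpace V m 0 :=
  (TensorProduct.mk ℚ (⨂[ℚ]^m V) (⨂[ℚ]^0 (Module.Dual ℚ V))).flip
    (PiTensorProduct.tprod ℚ (Fin.elim0 : Fin 0 → Module.Dual ℚ V))

/-- `toTensorSpaceZero V m x = x ⊗ ⊗()`. [cite: Deligne1982HodgeCycles, I §3.1] -/
@[simp]
theorem toTensorSpaceZero_apply (m : ℕ) (x : ⨂[ℚ]^m V) :
    toTensorSpaceZero V m x =
      x ⊗ₜ[ℚ] PiTensorProduct.tprod ℚ (Fin.elim0 : Fin 0 → Module.Dual ℚ V) :=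
  rfl

/-- `x ↦ x ⊗ ⊗()` is injective (`(V^∨)^{⊗0} ≅ ℚ` by Mathlib's `PiTensorProduct.isEmptyEquiv`, under
which it becomes `x ↦ x ⊗ 1`, inverted by `TensorProduct.rid`). [cite: Deligne1982HodgeCycles, I §3.1] -/
theorem toTensorSpaceZero_injective (m : ℕ) : Function.Injective (toTensorSpaceZero V m) := by
  intro x y h
  have key : ∀ z : ⨂[ℚ]^m V, TensorProduct.rid ℚ (⨂[ℚ]^m V)
      (LinearMap.lTensor (⨂[ℚ]^m V)
        (PiTensorProduct.isEmptyEquiv (Fin 0) :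
          (⨂[ℚ]^0 (Module.Dual ℚ V)) ≃ₗ[ℚ] ℚ).toLinearMap (toTensorSpaceZero V m z)) = z :=
    fun z ↦ by simp [toTensorSpaceZero_apply, PiTensorProduct.isEmptyEquiv_apply_tprod]
  rw [← key x, ← key y, h]

/-- Weight bookkeeping: the tensor space `T^{m,0}` has weight `(m - 0) n = m n`, the weight of the
tensor power `H^{⊗m}` (Deligne, LNM 900, I §3.1: `T^{a,b}` has weight `(a - b) n`).
[cite: Deligne1982HodgeCycles, I §3.1] -/
theorem tensorSpaceZero_weight (m : ℕ) (n : ℤ) :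
    (((m : ℕ) : ℤ) - ((0 : ℕ) : ℤ)) * n = (m : ℤ) * n := by
  simp

/-- After complexification, `x ↦ x ⊗ ⊗()` reads `X ↦ X ⊗ (1 ⊗ ⊗())` through the comparison
`tensorBaseChange`. Private plumbing. [folklore] -/
private theorem tensorBaseChange_toTensorSpaceZero_baseChange (m : ℕ)
    (X : ℂ ⊗[ℚ] ⨂[ℚ]^m V) :
    tensorBaseChange (⨂[ℚ]^m V) (⨂[ℚ]^0 (Module.Dual ℚ V))
        ((toTensorSpaceZero V m).baseChange ℂ X) =
      X ⊗ₜ[ℂ] ((1 : ℂ) ⊗ₜ[ℚ] PiTensorProduct.tprod ℚ (Fin.elim0 : Fin 0 → Module.Dual ℚ V)) := by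
  induction X using TensorProduct.induction_on with
  | zero => rw [map_zero, map_zero, TensorProduct.zero_tmul]
  | tmul c x => rw [LinearMap.baseChange_tmul, toTensorSpaceZero_apply, tensorBaseChange_tmul]
  | add X Y hX hY => rw [map_add, map_add, hX, hY, TensorProduct.add_tmul]

variable [Module.Finite ℚ V] [HodgeTensorFacts.{u, u}]

/-- **`x ↦ x ⊗ ⊗()` is a morphism of Hodge structures `H^{⊗m} → T^{m,0} H`** (the second factor
`(H^∨)^{⊗0} = ℚ(0)` has `F⁰ = ⊤`, so `Fᵖ(H^{⊗m}) ⊗ ⊗() ⊆ Fᵖ ⊗ F⁰ ⊆ Fᵖ(T^{m,0})`; Deligne, Hodge II,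
1.1.12). The weight of the target is transported from `(m - 0) n` to `m n`.
[cite: DeligneHodgeII1971, 1.1.12] [cite: Deligne1982HodgeCycles, I §3.1] -/
def Hom.toTensorSpaceZero (H : HodgeStructure V n) (m : ℕ) :
    (H.tensorPower m).Hom ((H.tensorSpace m 0).cast (tensorSpaceZero_weight m n)) where
  toLinearMap := Motives.HodgeStructure.toTensorSpaceZero V m
  map_F_le p := by
    rintro _ ⟨X, hX, rfl⟩
    show _ ∈ (H.tensorPower m).tensorFiltration (H.dual.tensorPower 0) p
    exact mem_tensorFiltration_of_eq_tmul (H.tensorPower m) (H.dual.tensorPower 0) (α := p)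
      (β := 0) (by omega) hX (tmul_tprod_mem_tensorPowerFiltration_zero H.dual le_rfl 1 Fin.elim0)
      (tensorBaseChange_toTensorSpaceZero_baseChange m X)

/-- **Tensor powers of a polarisable Hodge structure are polarisable** (finite-dimensional `V`):
pull back the induced polarisation of the tensor space `T^{m,0} H` (Deligne, Hodge II, 2.1.15;
GGK I.A; the tree's `Polarization.tensorSpace`) along the injective morphism `x ↦ x ⊗ ⊗()`
(Voisin I, §7.1.2: the restriction of a polarisation to a sub-Hodge structure polarises it; the
tree's `Polarization.comap`). [cite: DeligneHodgeII1971, 2.1.15] [cite: VoisinHodgeI2002, §7.1.2 and §7.3.1] -/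
theorem IsPolarizable.tensorPower {H : HodgeStructure V n} (hH : H.IsPolarizable) (m : ℕ) :
    (H.tensorPower m).IsPolarizable := by
  obtain ⟨Q⟩ := (hH.tensorSpace m 0).cast (tensorSpaceZero_weight m n)
  exact ⟨Q.comap (Hom.toTensorSpaceZero H m) (toTensorSpaceZero_injective m)⟩

end TensorSpaceZero

/-! ### The generators `(H¹(A)^{⊗ m})(c)` and structures of abelian type are polarisable -/

section AbelianType

/-- **The generators `(H¹(A(ℂ); ℚ)^{⊗ m})(c)` of `ℳ(𝒜b)` (Hodge side) are polarisable**: `H¹(A)`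
is polarised (Voisin I, §7.1.2; the tree's theorem `smoothProjective_hodgeStructure_isPolarizable_holds`
for the smooth projective `A` and its Hodge symmetric model `M`), hence so are its tensor powers
(`IsPolarizable.tensorPower`), their Tate twists and weight transports (`IsPolarizable.tateTwist`,
`IsPolarizable.cast`; Deligne, Hodge II, 2.1.15). [cite: VoisinHodgeI2002, §7.1.2]
[cite: DeligneHodgeII1971, 2.1.15] [cite: Andre1996Motifs, Thm. 0.4 (p. 8) and §6.1 (p. 30)] -/
theorem isPolarizable_abelianTensor (A : AbelianVariety ℂ) (hA : IsSmoothProjective A.dim A.X)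
    (M : HodgeTheory.HodgeModel A.dim A.X) (hM : M.IsHodgeSymmetric) (m : ℕ) (c : ℤ) :
    (abelianTensor A hA M hM m c).IsPolarizable := by
  haveI := hodgeTensorFacts_holds.{0, 0}
  haveI : Module.Finite ℚ (singularCohomology ℚ ℚ (ComplexPoints A.X) 1) :=
    HodgeTheory.finiteDimensional_bettiCohomology hA 1
  have h1 : (M.hodgeStructure hA hM 1).IsPolarizable :=
    HodgeTheory.smoothProjective_hodgeStructure_isPolarizable_holds hA M hM 1
  exact ((h1.tensorPower m).tateTwist c).cast _

variable {w : ℤ}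

/-- **A `ℚ`-Hodge structure of abelian type is polarisable.** If `H` is a direct summand of
`(H¹(A)^{⊗ m})(c)` through morphisms `j : H → T`, `r : T → H` with `r ∘ j = id`, then `j` is
injective and the polarisation of `T` (`isPolarizable_abelianTensor`) pulled back along `j`
(Voisin I, §7.1.2 / §7.3.1: `Q'(x, y) = Q(j x, j y)`; the tree's `Polarization.comap`) polarises
`H`. André: `ℳ(𝒜b) ⊆ ℳ(𝒱)` is "semi-simple, polarisée" (Thm. 0.4).
[cite: Andre1996Motifs, Thm. 0.4 (p. 8) and §6.1 (p. 30)] [cite: VoisinHodgeI2002, §7.1.2 and §7.3.1] -/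
theorem IsOfAbelianType.isPolarizable {H : HodgeStructure V w} (h : H.IsOfAbelianType) :
    H.IsPolarizable := by
  obtain ⟨A, hA, M, hM, m, c, hw, j, r, hjr⟩ := h
  obtain ⟨Q⟩ := (isPolarizable_abelianTensor A hA M hM m c).cast hw
  exact ⟨Q.comap j (Function.LeftInverse.injective hjr)⟩

/-- The underlying space of a Hodge structure of abelian type is finite-dimensional (it embeds, by
`j`, into `(H¹(A)^{⊗ m})(c)`, and `H¹(A(ℂ); ℚ)` is finite-dimensional). [cite: Andre1996Motifs, §6.1 (p. 30)] -/
theorem IsOfAbelianType.finiteDimensional {H : HodgeStructure V w} (h : H.IsOfAbelianType) :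
    Module.Finite ℚ V := by
  obtain ⟨A, hA, M, hM, m, c, hw, j, r, hjr⟩ := h
  haveI : Module.Finite ℚ (singularCohomology ℚ ℚ (ComplexPoints A.X) 1) :=
    HodgeTheory.finiteDimensional_bettiCohomology hA 1
  exact Module.Finite.of_injective j.toLinearMap (Function.LeftInverse.injective hjr)

/-- **Semisimplicity on structures of abelian type**: every sub-Hodge structure of a `ℚ`-Hodge
structure of abelian type has a complementary sub-Hodge structure (polarisable and
finite-dimensional: Voisin 2025 Prop. 2.11 / Voisin I Lemma 7.26, the tree's
`SubHodgeStructure.exists_isCompl`; André Thm. 0.4: `ℳ(𝒱)` is "semi-simple").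
[cite: Andre1996Motifs, Thm. 0.4 (p. 8)] [cite: VoisinHodgeI2002, Lemma 7.26] -/
theorem IsOfAbelianType.exists_isCompl {H : HodgeStructure V w} (h : H.IsOfAbelianType)
    (S : SubHodgeStructure H) : ∃ S' : SubHodgeStructure H, IsCompl S.toSubmodule S'.toSubmodule :=
  haveI := h.finiteDimensional
  SubHodgeStructure.exists_isCompl h.isPolarizable S

end AbelianType

end HodgeStructure

end Literature.AlgebraicGeometry.Motives

end
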